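import Summits.HodgeConjecture.HodgeConjecture.Theorems.CyclicUnitaryPowersHeredityAlongCurves
import Literature.AlgebraicGeometry.HodgeTheory.CyclicCoverLinearPencil
import Literature.AlgebraicGeometry.FundamentalGroup.HypersurfaceComplementMeridiansGenerate
import Mathlib.Analysis.Normed.Module.Connected
import Mathlib.LinearAlgebra.Complex.FiniteDimensional
import HarnessLib

/-!
# Route CyclicUnitaryPowers — HEREDITY ON PENCILS: every pencil `x₃^p = f₀ + u·g` through a base point `f₀` with a
# finite-index monodromy subgroup in its Mumford–Tate group has that property — hence the Hodge conjecture on all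
# self-powers — at ALL BUT COUNTABLY MANY members, for EVERY direction `g`; the DICHOTOMY for the exceptional set

Support file for `stmt-HodgeConjecture-19544` (`--supports … --as helper`; nothing here closes an item). Prover seat
`hodge-nonav-prover-Ax` (g16, cell hodge-nonav), programme «HEREDITY» (H3∕H4).

`p ≥ 7` prime; `S = cyclicCoverBase p` the Carlson–Toledo base, `u : 𝒴 ⟶ S` its family; for a ternary coefficient vector
`b` write `pt b = cyclicCoverPoint p (Σ_e b_e x^e) ∈ S(ℂ)` (meaningful when `x₃^p − Σ b_e x^e` is nonsingular) and **FI(b)**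
for «some finite-index subgroup of the monodromy group `Γ_{pt b}` lies in `MT(H²(𝒴_{pt b}))(ℚ)`» (Hodge-symmetric models
`A`; the hypothesis is kept EXPLICIT on the point — Hodge-genericity of `pt b` implies it by Deligne's lemma, see
`CyclicUnitaryPowersHeredityAlongCurves.hodgeConjectureFor_powers_offCountable_of_curve_of_isHodgeGenericPoint`).

* `pathConnectedSpace_pencilBase` — the complex points of the pencil base (the `u` with `x₃^p − (f₀ + u g)` nonsingular,
  a cofinite subset of `ℂ`, `pencilChart`) are path connected.
* **`exists_countable_finiteIndex_of_pencil`** (H4, pointed form) — FI(f₀) ⇒ for EVERY `g` there is a countable `C ⊆ ℂ` with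
  FI(f₀ + u g) for all `u ∉ C` with `x₃^p − (f₀ + u g)` nonsingular.
* **`hodgeConjectureFor_powers_offCountable_of_pencil_of_finiteIndex`** (H3) — FI(f₀) ⇒ for EVERY `g`, for all but countably
  many `u`, every smooth projective `X ⊂ ℙ³` cut out by `x₃^p − Σ_e ((f₀)_e + u g_e) x^e` and every self fibre power
  `Y = X^{k+1}` satisfy `HodgeConjectureFor (2(k+1)) Y`.  Compare `exists_goodPencil_through` (g15, every-base): there SOME
  direction `g` through every smooth `f₀` (an ALGEBRAIC condition on the pair); here EVERY direction through an `f₀` with FI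
  (a TRANSCENDENTAL condition on the base point alone).
* **`finiteIndex_pencil_dichotomy`** (H4) — for every pencil `(f₀, g)`: if ONE nonsingular member `f₀ + u₀ g` has FI then all but
  countably many do; equivalently the FI-exceptional set meets every line of the coefficient space either in ALL its
  nonsingular members or in a countable set.

HONEST FRAMING: structural, unconditional (axioms standard, no named fact); FI at the seed is a hypothesis; the countable
exceptional sets are unspecified; items 19544 ∕ 19543 stay OPEN at their Cattani–Deligne–Kaplan floor (reading (b) asks for
a countable union of ALGEBRAIC subsets of the whole coefficient space); rung F-H1 not moved; nothing here says HC ∕ HC_CM ∕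
HC_AV is proved.

## References
* [CarlsonMullerStachPeters2017] J. Carlson, S. Müller-Stach, C. Peters, Period Mappings and Period Domains, 2nd ed.,
  §15.3 (15.7), Lemma–Def. 15.3.7.
* [Deligne1972WeilK3] P. Deligne, La conjecture de Weil pour les surfaces K3, Invent. Math. 15 (1972), Prop. 7.5.
* [CarlsonToledo1999] J. A. Carlson, D. Toledo, Duke Math. J. 97 (1999), §2, §7 Theorem 7.1.
* [VoisinHodgeII2003] C. Voisin, *Hodge Theory and Complex Algebraic Geometry II*, §3.1.2, §6.2.1.
-/

noncomputable section

set_option linter.dupNamespace false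

namespace Summit.HodgeConjecture.HodgeConjecture.Theorems.CyclicUnitaryPowersHeredity

open scoped TensorProduct Topology
open CategoryTheory CategoryTheory.Limits AlgebraicGeometry Set
open _root_.Topology _root_.Filter
open Literature.AlgebraicGeometry.Motives Literature.AlgebraicGeometry.HodgeTheory
open Literature.AlgebraicGeometry.HodgeTheory.BettiUniverse
open Literature.AlgebraicGeometry.Motives.UniversalHypersurface Literature.AlgebraicGeometry.HodgeTheory.UniversalHypersurface
open Literature.AlgebraicGeometry.HodgeTheory.LinearPencil
open Literature.AlgebraicGeometry.FundamentalGroup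
open Literature.AlgebraicGeometry.Motives.SmoothHypersurface (IsNonsingularForm)
open Literature.AlgebraicTopology.SingularHomology
open Summit.HodgeConjecture.HodgeConjecture.Theorems.CyclicUnitaryPowersGenericCyclicSurfacePowersHodge

/-! ### §1 The pencil base is path connected -/

/-- The nonsingular parameters of a pencil `x₃^p = f₀ + u g` with `x₃^p − f₀` nonsingular form a COFINITE subset of `ℂ`
(the roots of the non-zero restriction `u ↦ D(f₀ + u g)` of a discriminant equation `D`), hence a path-connected one
(`ℂ` has real dimension `2 > 1`). [cite: VoisinHodgeII2003, §2.1 (pencils of hypersurfaces)] -/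
theorem isPathConnected_setOf_isNonsingularForm_pencil {p : ℕ} [NeZero p] (hp : 2 ≤ p) (f₀ g : TernaryIndex p → ℂ)
    (hf₀ : IsNonsingularForm ℂ (cyclicCoverForm p (∑ e : TernaryIndex p, MvPolynomial.monomial e.1 (f₀ e)))) :
    IsPathConnected {u : ℂ | IsNonsingularForm ℂ (cyclicCoverForm p
      (∑ e : TernaryIndex p, MvPolynomial.monomial e.1 (f₀ e + u * g e)))} := by
  classical
  obtain ⟨D, -, hD⟩ := exists_irreducible_discriminantEquation (p := p) hp
  have hf₀U : f₀ ∈ affineHypersurfaceComplement ![D] := by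
    rw [mem_affineHypersurfaceComplement_iff]
    intro j
    fin_cases j
    exact fun h0 => (hD f₀).1 h0 hf₀
  have hfin : (lineRoots ![D] f₀ g).Finite := lineRoots_finite hf₀U g
  have heq : {u : ℂ | IsNonsingularForm ℂ (cyclicCoverForm p
      (∑ e : TernaryIndex p, MvPolynomial.monomial e.1 (f₀ e + u * g e)))} = (lineRoots ![D] f₀ g)ᶜ := by
    ext u
    simp only [mem_setOf_eq, mem_compl_iff, lineRoots]
    constructor
    · rintro hu ⟨j, hj⟩
      fin_cases j
      have hfu : (f₀ + u • g) = fun e => f₀ e + u * g e := by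
        funext e; simp [Pi.add_apply, Pi.smul_apply, smul_eq_mul]
      change MvPolynomial.eval (f₀ + u • g) D = 0 at hj
      rw [hfu] at hj
      exact (hD _).1 hj hu
    · intro hu
      by_contra hns
      refine hu ⟨0, ?_⟩
      have hfu : (f₀ + u • g) = fun e => f₀ e + u * g e := by
        funext e; simp [Pi.add_apply, Pi.smul_apply, smul_eq_mul]
      change MvPolynomial.eval (f₀ + u • g) D = 0
      rw [hfu]
      exact (hD _).2 hns
  rw [heq]
  exact hfin.countable.isPathConnected_compl_of_one_lt_rank (by rw [Complex.rank_real_complex]; norm_num)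

/-- **The complex points of the pencil base are path connected** (`g ≠ 0`, `x₃^p − f₀` nonsingular): `P(ℂ)` is homeomorphic
(`pencilChart`) to the cofinite set of nonsingular parameters. [cite: VoisinHodgeII2003, §2.1] -/
theorem pathConnectedSpace_pencilBase {p : ℕ} [NeZero p] (hp : 2 ≤ p) (f₀ : TernaryIndex p → ℂ) {g : TernaryIndex p → ℂ}
    (hg : g ≠ 0) (hf₀ : IsNonsingularForm ℂ (cyclicCoverForm p (∑ e : TernaryIndex p, MvPolynomial.monomial e.1 (f₀ e)))) :
    PathConnectedSpace (ComplexPoints (pencilBase p f₀ g)) := by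
  haveI : PathConnectedSpace {u : ℂ | IsNonsingularForm ℂ (cyclicCoverForm p
      (∑ e : TernaryIndex p, MvPolynomial.monomial e.1 (f₀ e + u * g e)))} :=
    isPathConnected_iff_pathConnectedSpace.1 (isPathConnected_setOf_isNonsingularForm_pencil hp f₀ g hf₀)
  exact (pencilChart p f₀ hg).symm.surjective.pathConnectedSpace (pencilChart p f₀ hg).symm.continuous

/-! ### §2 Heredity on pencils -/

/-- The classifying point of the ternary form with coefficient vector `b` (nonsingular cyclic cover form) has branch-form
coefficients `b`. [cite: CarlsonToledo1999, §2 (held text p0004)] -/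
theorem coeff_branchForm_cyclicCoverPoint_sum_monomial {p : ℕ} [NeZero p] (b : TernaryIndex p → ℂ)
    (hb : IsNonsingularForm ℂ (cyclicCoverForm p (∑ e : TernaryIndex p, MvPolynomial.monomial e.1 (b e))))
    (e : TernaryIndex p) :
    (branchForm p (cyclicCoverPoint p (∑ e : TernaryIndex p, MvPolynomial.monomial e.1 (b e)))).coeff e.1 = b e := by
  rw [coeffChart_cyclicCoverPoint (isHomogeneous_sum_monomial p b) hb e]
  exact coeff_sum_monomial p b e

/-- Along the pencil `ι = pencilMap p f₀ g`, the image of a point `c` is the classifying point of `f₀ + (pencilCoord c)·g`.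
[cite: CarlsonToledo1999, §2 (held text p0004)] -/
theorem map_pencilMap_eq_cyclicCoverPoint {p : ℕ} [NeZero p] (f₀ g : TernaryIndex p → ℂ)
    (c : ComplexPoints (pencilBase p f₀ g)) :
    AlgPoints.map (pencilMap p f₀ g) c =
      cyclicCoverPoint p (∑ e : TernaryIndex p, MvPolynomial.monomial e.1 (f₀ e + pencilCoord p f₀ g c * g e)) := by
  apply coeffChart_injective p
  funext e
  change (branchForm p (AlgPoints.map (pencilMap p f₀ g) c)).coeff e.1 = (branchForm p (cyclicCoverPoint p _)).coeff e.1
  rw [coeff_branchForm_map_pencilMap,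
    coeff_branchForm_cyclicCoverPoint_sum_monomial _ (isNonsingularForm_pencilCoord p f₀ g c)]

/-- **HEREDITY ON PENCILS (pointed form).** `p ≥ 7` prime; `f₀, g` ternary coefficient vectors with `x₃^p − f₀` nonsingular;
Hodge-symmetric models `A`. If some finite-index subgroup of the monodromy group of the Carlson–Toledo family at the classifying
point of `f₀` lies in `MT(H²)` (`hFI`), then there is a COUNTABLE `C ⊆ ℂ` such that the same holds at the classifying point of
`f₀ + u g` for every `u ∉ C` with `x₃^p − (f₀ + u g)` nonsingular — for EVERY direction `g`.
[cite: CarlsonMullerStachPeters2017, §15.3 (15.7) and Lemma–Definition 15.3.7] [cite: Deligne1972WeilK3, Prop. 7.5]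
[cite: VoisinHodgeII2003, §3.1.2 and §6.2.1] -/
theorem exists_countable_finiteIndex_of_pencil {p : ℕ} (hp : p.Prime) (h7 : 7 ≤ p) (f₀ g : TernaryIndex p → ℂ)
    (hf₀ : haveI : NeZero p := ⟨hp.ne_zero⟩
      IsNonsingularForm ℂ (cyclicCoverForm p (∑ e : TernaryIndex p, MvPolynomial.monomial e.1 (f₀ e))))
    (A : haveI : NeZero p := ⟨hp.ne_zero⟩; ∀ t : ComplexPoints (cyclicCoverBase p), HodgeModel 2 (fiberOver (cyclicCoverFamily p) t))
    (hA : ∀ t, (A t).IsHodgeSymmetric)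
    (hFI : haveI : NeZero p := ⟨hp.ne_zero⟩
      haveI : HodgeTensorFacts.{0, 0} := hodgeTensorFacts_holds
      haveI : ∀ t : ComplexPoints (cyclicCoverBase p), Module.Finite ℚ (bettiCohomology (fiberOver (cyclicCoverFamily p) t) 2) :=
        fun t => finite ((isSmoothProjectiveFamily_cyclicCoverFamily p).isSmoothProjective t) 2
      letI t₀ := cyclicCoverPoint p (∑ e : TernaryIndex p, MvPolynomial.monomial e.1 (f₀ e))
      ∃ Γ₀ : Subgroup (bettiCohomology (fiberOver (cyclicCoverFamily p) t₀) 2 ≃ₗ[ℚ]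
          bettiCohomology (fiberOver (cyclicCoverFamily p) t₀) 2),
        Γ₀ ≤ ratMonodromyGroup (cyclicCoverFamily p) 2 (cyclicCoverFamily_locallyTrivial p) ⟨t₀, Set.mem_univ _⟩ ∧
        (Γ₀.subgroupOf (ratMonodromyGroup (cyclicCoverFamily p) 2 (cyclicCoverFamily_locallyTrivial p) ⟨t₀, Set.mem_univ _⟩)).FiniteIndex ∧
        Γ₀ ≤ ((A t₀).hodgeStructure ((isSmoothProjectiveFamily_cyclicCoverFamily p).isSmoothProjective t₀) (hA t₀) 2).mumfordTateGroup) :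
    haveI : NeZero p := ⟨hp.ne_zero⟩
    haveI : HodgeTensorFacts.{0, 0} := hodgeTensorFacts_holds
    haveI : ∀ t : ComplexPoints (cyclicCoverBase p), Module.Finite ℚ (bettiCohomology (fiberOver (cyclicCoverFamily p) t) 2) :=
      fun t => finite ((isSmoothProjectiveFamily_cyclicCoverFamily p).isSmoothProjective t) 2
    ∃ C : Set ℂ, C.Countable ∧ ∀ u : ℂ, u ∉ C →
      IsNonsingularForm ℂ (cyclicCoverForm p (∑ e : TernaryIndex p, MvPolynomial.monomial e.1 (f₀ e + u * g e))) →
      letI t := cyclicCoverPoint p (∑ e : TernaryIndex p, MvPolynomial.monomial e.1 (f₀ e + u * g e))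
      ∃ Γ₁ : Subgroup (bettiCohomology (fiberOver (cyclicCoverFamily p) t) 2 ≃ₗ[ℚ]
          bettiCohomology (fiberOver (cyclicCoverFamily p) t) 2),
        Γ₁ ≤ ratMonodromyGroup (cyclicCoverFamily p) 2 (cyclicCoverFamily_locallyTrivial p) ⟨t, Set.mem_univ _⟩ ∧
        (Γ₁.subgroupOf (ratMonodromyGroup (cyclicCoverFamily p) 2 (cyclicCoverFamily_locallyTrivial p) ⟨t, Set.mem_univ _⟩)).FiniteIndex ∧
        Γ₁ ≤ ((A t).hodgeStructure ((isSmoothProjectiveFamily_cyclicCoverFamily p).isSmoothProjective t) (hA t) 2).mumfordTateGroup := by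
  classical
  haveI : NeZero p := ⟨hp.ne_zero⟩
  haveI : HodgeTensorFacts.{0, 0} := hodgeTensorFacts_holds
  have hp2 : 2 ≤ p := by omega
  have hf := isSmoothProjectiveFamily_cyclicCoverFamily p
  have hU := cyclicCoverFamily_locallyTrivial p
  haveI : ∀ t : ComplexPoints (cyclicCoverBase p), Module.Finite ℚ (bettiCohomology (fiberOver (cyclicCoverFamily p) t) 2) :=
    fun t => finite (hf.isSmoothProjective t) 2
  -- transport of FI along an equality of points
  have key : ∀ (t t' : ComplexPoints (cyclicCoverBase p)), t = t' →
      (∃ Γ₁ : Subgroup (bettiCohomology (fiberOver (cyclicCoverFamily p) t) 2 ≃ₗ[ℚ]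
          bettiCohomology (fiberOver (cyclicCoverFamily p) t) 2),
        Γ₁ ≤ ratMonodromyGroup (cyclicCoverFamily p) 2 hU ⟨t, Set.mem_univ _⟩ ∧
        (Γ₁.subgroupOf (ratMonodromyGroup (cyclicCoverFamily p) 2 hU ⟨t, Set.mem_univ _⟩)).FiniteIndex ∧
        Γ₁ ≤ ((A t).hodgeStructure (hf.isSmoothProjective t) (hA t) 2).mumfordTateGroup) →
      ∃ Γ₁ : Subgroup (bettiCohomology (fiberOver (cyclicCoverFamily p) t') 2 ≃ₗ[ℚ]
          bettiCohomology (fiberOver (cyclicCoverFamily p) t') 2),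
        Γ₁ ≤ ratMonodromyGroup (cyclicCoverFamily p) 2 hU ⟨t', Set.mem_univ _⟩ ∧
        (Γ₁.subgroupOf (ratMonodromyGroup (cyclicCoverFamily p) 2 hU ⟨t', Set.mem_univ _⟩)).FiniteIndex ∧
        Γ₁ ≤ ((A t').hodgeStructure (hf.isSmoothProjective t') (hA t') 2).mumfordTateGroup := by
    rintro t t' rfl h; exact h
  by_cases hg : g = 0
  · -- constant pencil: every member is `f₀`
    subst hg
    refine ⟨∅, countable_empty, fun u _ _ => ?_⟩
    have heq : (∑ e : TernaryIndex p, MvPolynomial.monomial e.1 (f₀ e + u * (0 : TernaryIndex p → ℂ) e)) =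
        ∑ e : TernaryIndex p, MvPolynomial.monomial e.1 (f₀ e) :=
      Finset.sum_congr rfl fun e _ => by simp
    exact key _ _ (by rw [heq]) hFI
  · -- ### the pencil `ι : P ⟶ S`
    let φ' := pencilCompSpz p f₀ g
    let ι := pencilMap p f₀ g
    have hPq : IsQuasiProjectiveOver (pencilBase p f₀ g) := isQuasiProjectiveOver_baseSpz 2 p φ'
    haveI : SmoothOfRelativeDimension 1 (pencilBase p f₀ g).hom := by
      have h := smoothOfRelativeDimension_baseSpz_hom ℂ 2 p φ'
      rwa [Nat.card_eq_fintype_card, Fintype.card_fin] at h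
    -- the point `u = 0`
    have hns0 : IsNonsingularForm ℂ (cyclicCoverForm p (∑ e : TernaryIndex p, MvPolynomial.monomial e.1 (f₀ e + 0 * g e))) := by
      have heq : (∑ e : TernaryIndex p, MvPolynomial.monomial e.1 (f₀ e + 0 * g e)) =
          ∑ e : TernaryIndex p, MvPolynomial.monomial e.1 (f₀ e) := Finset.sum_congr rfl fun e _ => by simp
      rw [heq]; exact hf₀
    obtain ⟨c₀, hc₀⟩ := exists_pencilCoord_eq p f₀ g hns0
    haveI : IrreducibleSpace (pencilBase p f₀ g).left := irreducibleSpace_baseSpz_left ℂ 2 p φ' ⟨c₀.pt⟩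
    haveI : PathConnectedSpace (ComplexPoints (pencilBase p f₀ g)) := pathConnectedSpace_pencilBase hp2 f₀ hg hf₀
    have ht₀ : AlgPoints.map ι c₀ = cyclicCoverPoint p (∑ e : TernaryIndex p, MvPolynomial.monomial e.1 (f₀ e)) := by
      have heq : (∑ e : TernaryIndex p, MvPolynomial.monomial e.1 (f₀ e + pencilCoord p f₀ g c₀ * g e)) =
          ∑ e : TernaryIndex p, MvPolynomial.monomial e.1 (f₀ e) :=
        Finset.sum_congr rfl fun e _ => by rw [hc₀, zero_mul, add_zero]
      rw [map_pencilMap_eq_cyclicCoverPoint, heq]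
    -- ### heredity along the curve
    obtain ⟨C, hCc, hC⟩ := exists_countable_finiteIndex_of_curve hp h7 hPq ι A hA c₀ _ ht₀ hFI
    refine ⟨pencilCoord p f₀ g '' C, hCc.image _, fun u hu hns => ?_⟩
    obtain ⟨c, hcu⟩ := exists_pencilCoord_eq p f₀ g hns
    have hcC : c ∉ C := fun h => hu ⟨c, h, hcu⟩
    have hpt : AlgPoints.map ι c = cyclicCoverPoint p (∑ e : TernaryIndex p, MvPolynomial.monomial e.1 (f₀ e + u * g e)) := by
      rw [map_pencilMap_eq_cyclicCoverPoint, hcu]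
    exact key _ _ hpt (hC c hcC)

/-- **HC on all self-powers along EVERY pencil through a base point with FI** (H3). `p ≥ 7` prime; `f₀` with `x₃^p − f₀`
nonsingular and FI at its classifying point (`hFI`); ANY direction `g`. Then there is a countable `C ⊆ ℂ` such that for every
`u ∉ C`, every smooth projective `X ⊂ ℙ³` cut out by `x₃^p − Σ_e ((f₀)_e + u g_e) x^e` and every self fibre power `Y = X^{k+1}`
satisfy `HodgeConjectureFor (2(k+1)) Y`. Unconditional; NOT items 19544 ∕ 19543 (CDK floor).
[cite: CarlsonMullerStachPeters2017, §15.3 (15.7) and Lemma–Definition 15.3.7] [cite: CarlsonToledo1999, §7 Theorem 7.1]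
[cite: Deligne1972WeilK3, Prop. 7.5] -/
theorem hodgeConjectureFor_powers_offCountable_of_pencil_of_finiteIndex {p : ℕ} (hp : p.Prime) (h7 : 7 ≤ p)
    (f₀ g : TernaryIndex p → ℂ)
    (hf₀ : haveI : NeZero p := ⟨hp.ne_zero⟩
      IsNonsingularForm ℂ (cyclicCoverForm p (∑ e : TernaryIndex p, MvPolynomial.monomial e.1 (f₀ e))))
    (A : haveI : NeZero p := ⟨hp.ne_zero⟩; ∀ t : ComplexPoints (cyclicCoverBase p), HodgeModel 2 (fiberOver (cyclicCoverFamily p) t))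
    (hA : ∀ t, (A t).IsHodgeSymmetric)
    (hFI : haveI : NeZero p := ⟨hp.ne_zero⟩
      haveI : HodgeTensorFacts.{0, 0} := hodgeTensorFacts_holds
      haveI : ∀ t : ComplexPoints (cyclicCoverBase p), Module.Finite ℚ (bettiCohomology (fiberOver (cyclicCoverFamily p) t) 2) :=
        fun t => finite ((isSmoothProjectiveFamily_cyclicCoverFamily p).isSmoothProjective t) 2
      letI t₀ := cyclicCoverPoint p (∑ e : TernaryIndex p, MvPolynomial.monomial e.1 (f₀ e))
      ∃ Γ₀ : Subgroup (bettiCohomology (fiberOver (cyclicCoverFamily p) t₀) 2 ≃ₗ[ℚ]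
          bettiCohomology (fiberOver (cyclicCoverFamily p) t₀) 2),
        Γ₀ ≤ ratMonodromyGroup (cyclicCoverFamily p) 2 (cyclicCoverFamily_locallyTrivial p) ⟨t₀, Set.mem_univ _⟩ ∧
        (Γ₀.subgroupOf (ratMonodromyGroup (cyclicCoverFamily p) 2 (cyclicCoverFamily_locallyTrivial p) ⟨t₀, Set.mem_univ _⟩)).FiniteIndex ∧
        Γ₀ ≤ ((A t₀).hodgeStructure ((isSmoothProjectiveFamily_cyclicCoverFamily p).isSmoothProjective t₀) (hA t₀) 2).mumfordTateGroup) :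
    ∃ C : Set ℂ, C.Countable ∧ ∀ u : ℂ, u ∉ C →
      ∀ ⦃X : SchemeOver ℂ⦄, IsSmoothProjective 2 X →
        IsHypersurfaceCutOutBy 3 (MvPolynomial.X (Fin.last 3) ^ p - MvPolynomial.rename Fin.castSucc
          (∑ e : TernaryIndex p, MvPolynomial.monomial e.1 (f₀ e + u * g e))) X →
        ∀ ⦃k : ℕ⦄ ⦃Y : SchemeOver ℂ⦄, (∃ π : Fin (k + 1) → (Y ⟶ X), Nonempty (IsLimit (Fan.mk Y π))) →
          HodgeConjectureFor (2 * (k + 1)) Y := by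
  classical
  haveI : NeZero p := ⟨hp.ne_zero⟩
  have hp2 : 2 ≤ p := by omega
  obtain ⟨C, hCc, hC⟩ := exists_countable_finiteIndex_of_pencil hp h7 f₀ g hf₀ A hA hFI
  -- the singular parameters are finitely many: add them to the exceptional set
  obtain ⟨D, -, hD⟩ := exists_irreducible_discriminantEquation (p := p) hp2
  have hf₀U : f₀ ∈ affineHypersurfaceComplement ![D] := by
    rw [mem_affineHypersurfaceComplement_iff]
    intro j
    fin_cases j
    exact fun h0 => (hD f₀).1 h0 hf₀
  refine ⟨C ∪ lineRoots ![D] f₀ g, hCc.union (lineRoots_finite hf₀U g).countable, fun u hu X hX hcut k Y hY => ?_⟩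
  rw [mem_union, not_or] at hu
  obtain ⟨hu1, hu2⟩ := hu
  have hns : IsNonsingularForm ℂ (cyclicCoverForm p (∑ e : TernaryIndex p, MvPolynomial.monomial e.1 (f₀ e + u * g e))) := by
    by_contra hc
    refine hu2 ⟨0, ?_⟩
    have hfu : (f₀ + u • g) = fun e => f₀ e + u * g e := by
      funext e; simp [Pi.add_apply, Pi.smul_apply, smul_eq_mul]
    change MvPolynomial.eval (f₀ + u • g) D = 0
    rw [hfu]
    exact (hD _).2 hc
  have hFIu := hC u hu1 hns
  have hpoly : (∑ e : TernaryIndex p, MvPolynomial.monomial e.1 ((branchForm p (cyclicCoverPoint p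
      (∑ e : TernaryIndex p, MvPolynomial.monomial e.1 (f₀ e + u * g e)))).coeff e.1)) =
      ∑ e : TernaryIndex p, MvPolynomial.monomial e.1 (f₀ e + u * g e) :=
    Finset.sum_congr rfl fun e _ => by rw [coeff_branchForm_cyclicCoverPoint_sum_monomial _ hns]
  have hcut' := hcut
  rw [← hpoly] at hcut'
  exact hodgeConjectureFor_powers_of_finiteIndex_at hp h7 A hA _ hFIu hX hcut' hY

/-! ### §3 The dichotomy -/

/-- **THE FI-DICHOTOMY ON LINES (H4).** `p ≥ 7` prime; `(f₀, g)` any pointed line of ternary coefficient vectors;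
Hodge-symmetric models `A`. If ONE nonsingular member `f₀ + u₀ g` of the pencil has a finite-index subgroup of its monodromy
group inside its Mumford–Tate group, then there is a countable `C ⊆ ℂ` such that EVERY nonsingular member `f₀ + u g`, `u ∉ C`,
has. Equivalently: the set of nonsingular parameters `u` at which FI FAILS is either ALL of them or countable — the
FI-exceptional locus of the coefficient space meets every line in all its nonsingular points or in a countable set.
[cite: CarlsonMullerStachPeters2017, §15.3 (15.7) and Lemma–Definition 15.3.7] [cite: Deligne1972WeilK3, Prop. 7.5]
[cite: VoisinHodgeII2003, §3.1.2 and §6.2.1] -/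
theorem finiteIndex_pencil_dichotomy {p : ℕ} (hp : p.Prime) (h7 : 7 ≤ p) (f₀ g : TernaryIndex p → ℂ)
    (A : haveI : NeZero p := ⟨hp.ne_zero⟩; ∀ t : ComplexPoints (cyclicCoverBase p), HodgeModel 2 (fiberOver (cyclicCoverFamily p) t))
    (hA : ∀ t, (A t).IsHodgeSymmetric) (u₀ : ℂ)
    (hu₀ : haveI : NeZero p := ⟨hp.ne_zero⟩
      IsNonsingularForm ℂ (cyclicCoverForm p (∑ e : TernaryIndex p, MvPolynomial.monomial e.1 (f₀ e + u₀ * g e))))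
    (hFI : haveI : NeZero p := ⟨hp.ne_zero⟩
      haveI : HodgeTensorFacts.{0, 0} := hodgeTensorFacts_holds
      haveI : ∀ t : ComplexPoints (cyclicCoverBase p), Module.Finite ℚ (bettiCohomology (fiberOver (cyclicCoverFamily p) t) 2) :=
        fun t => finite ((isSmoothProjectiveFamily_cyclicCoverFamily p).isSmoothProjective t) 2
      letI t₀ := cyclicCoverPoint p (∑ e : TernaryIndex p, MvPolynomial.monomial e.1 (f₀ e + u₀ * g e))
      ∃ Γ₀ : Subgroup (bettiCohomology (fiberOver (cyclicCoverFamily p) t₀) 2 ≃ₗ[ℚ]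
          bettiCohomology (fiberOver (cyclicCoverFamily p) t₀) 2),
        Γ₀ ≤ ratMonodromyGroup (cyclicCoverFamily p) 2 (cyclicCoverFamily_locallyTrivial p) ⟨t₀, Set.mem_univ _⟩ ∧
        (Γ₀.subgroupOf (ratMonodromyGroup (cyclicCoverFamily p) 2 (cyclicCoverFamily_locallyTrivial p) ⟨t₀, Set.mem_univ _⟩)).FiniteIndex ∧
        Γ₀ ≤ ((A t₀).hodgeStructure ((isSmoothProjectiveFamily_cyclicCoverFamily p).isSmoothProjective t₀) (hA t₀) 2).mumfordTateGroup) :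
    haveI : NeZero p := ⟨hp.ne_zero⟩
    haveI : HodgeTensorFacts.{0, 0} := hodgeTensorFacts_holds
    haveI : ∀ t : ComplexPoints (cyclicCoverBase p), Module.Finite ℚ (bettiCohomology (fiberOver (cyclicCoverFamily p) t) 2) :=
      fun t => finite ((isSmoothProjectiveFamily_cyclicCoverFamily p).isSmoothProjective t) 2
    ∃ C : Set ℂ, C.Countable ∧ ∀ u : ℂ, u ∉ C →
      IsNonsingularForm ℂ (cyclicCoverForm p (∑ e : TernaryIndex p, MvPolynomial.monomial e.1 (f₀ e + u * g e))) →
      letI t := cyclicCoverPoint p (∑ e : TernaryIndex p, MvPolynomial.monomial e.1 (f₀ e + u * g e))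
      ∃ Γ₁ : Subgroup (bettiCohomology (fiberOver (cyclicCoverFamily p) t) 2 ≃ₗ[ℚ]
          bettiCohomology (fiberOver (cyclicCoverFamily p) t) 2),
        Γ₁ ≤ ratMonodromyGroup (cyclicCoverFamily p) 2 (cyclicCoverFamily_locallyTrivial p) ⟨t, Set.mem_univ _⟩ ∧
        (Γ₁.subgroupOf (ratMonodromyGroup (cyclicCoverFamily p) 2 (cyclicCoverFamily_locallyTrivial p) ⟨t, Set.mem_univ _⟩)).FiniteIndex ∧
        Γ₁ ≤ ((A t).hodgeStructure ((isSmoothProjectiveFamily_cyclicCoverFamily p).isSmoothProjective t) (hA t) 2).mumfordTateGroup := by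
  classical
  haveI : NeZero p := ⟨hp.ne_zero⟩
  haveI : HodgeTensorFacts.{0, 0} := hodgeTensorFacts_holds
  have hf := isSmoothProjectiveFamily_cyclicCoverFamily p
  have hU := cyclicCoverFamily_locallyTrivial p
  haveI : ∀ t : ComplexPoints (cyclicCoverBase p), Module.Finite ℚ (bettiCohomology (fiberOver (cyclicCoverFamily p) t) 2) :=
    fun t => finite (hf.isSmoothProjective t) 2
  -- transport of FI along an equality of points
  have key : ∀ (t t' : ComplexPoints (cyclicCoverBase p)), t = t' →
      (∃ Γ₁ : Subgroup (bettiCohomology (fiberOver (cyclicCoverFamily p) t) 2 ≃ₗ[ℚ]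
          bettiCohomology (fiberOver (cyclicCoverFamily p) t) 2),
        Γ₁ ≤ ratMonodromyGroup (cyclicCoverFamily p) 2 hU ⟨t, Set.mem_univ _⟩ ∧
        (Γ₁.subgroupOf (ratMonodromyGroup (cyclicCoverFamily p) 2 hU ⟨t, Set.mem_univ _⟩)).FiniteIndex ∧
        Γ₁ ≤ ((A t).hodgeStructure (hf.isSmoothProjective t) (hA t) 2).mumfordTateGroup) →
      ∃ Γ₁ : Subgroup (bettiCohomology (fiberOver (cyclicCoverFamily p) t') 2 ≃ₗ[ℚ]
          bettiCohomology (fiberOver (cyclicCoverFamily p) t') 2),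
        Γ₁ ≤ ratMonodromyGroup (cyclicCoverFamily p) 2 hU ⟨t', Set.mem_univ _⟩ ∧
        (Γ₁.subgroupOf (ratMonodromyGroup (cyclicCoverFamily p) 2 hU ⟨t', Set.mem_univ _⟩)).FiniteIndex ∧
        Γ₁ ≤ ((A t').hodgeStructure (hf.isSmoothProjective t') (hA t') 2).mumfordTateGroup := by
    rintro t t' rfl h; exact h
  -- recentre the pencil at `f₀' = f₀ + u₀ g`: its member of parameter `u - u₀` is `f₀ + u g`
  let f₀' : TernaryIndex p → ℂ := fun e => f₀ e + u₀ * g e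
  have hsum : ∀ v : ℂ, (∑ e : TernaryIndex p, MvPolynomial.monomial e.1 (f₀' e + v * g e)) =
      ∑ e : TernaryIndex p, MvPolynomial.monomial e.1 (f₀ e + (v + u₀) * g e) := fun v =>
    Finset.sum_congr rfl fun e _ => by
      change MvPolynomial.monomial e.1 (f₀ e + u₀ * g e + v * g e) = _
      congr 1; ring
  have hf₀' : IsNonsingularForm ℂ (cyclicCoverForm p (∑ e : TernaryIndex p, MvPolynomial.monomial e.1 (f₀' e))) := hu₀
  obtain ⟨C, hCc, hC⟩ := exists_countable_finiteIndex_of_pencil hp h7 f₀' g hf₀' A hA hFI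
  refine ⟨(fun v => v + u₀) '' C, hCc.image _, fun u hu hns => ?_⟩
  have huC : u - u₀ ∉ C := fun h => hu ⟨u - u₀, h, by simp⟩
  have heq : (∑ e : TernaryIndex p, MvPolynomial.monomial e.1 (f₀' e + (u - u₀) * g e)) =
      ∑ e : TernaryIndex p, MvPolynomial.monomial e.1 (f₀ e + u * g e) := by
    rw [hsum (u - u₀), sub_add_cancel]
  have hns' : IsNonsingularForm ℂ (cyclicCoverForm p
      (∑ e : TernaryIndex p, MvPolynomial.monomial e.1 (f₀' e + (u - u₀) * g e))) := by
    rw [heq]; exact hns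
  exact key _ _ (by rw [heq]) (hC (u - u₀) huC hns')

end Summit.HodgeConjecture.HodgeConjecture.Theorems.CyclicUnitaryPowersHeredity

end
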